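import Summits.AtomisticToContinuum.HydrodynamicLimit.Theorems.RelayRaceLocalityNearConstantShortTimeHLSmallTiltGronwallDefs
import Summits.AtomisticToContinuum.HydrodynamicLimit.Theorems.SuperextensiveClosureCostBlockEntropyBudgetBallAverages
import Literature.MathematicalPhysics.KineticTheory.HardSphereEulerProofs
import HarnessLib

/-!
# Crux `NearConstantShortTimeHL` (stmt-AtomisticToContinuum-12502), line `small-tilt-domination`:
# deterministic kinetic inequalities for the ball-averaged empirical fields

Registered stubs `integral_ballAverage_eq`, `norm_ballMomentum_sq_le`, `norm_ballMomentum_le`,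
`ballEnergy_le_trunc`, `ballEnergy_mul_norm_ballMomentum_le`, `ballCubic_le_trunc` of the line
`small-tilt-domination` (Gronwall assembly, fluxes on BAD balls).

With the nonnegative weights `kᵢ := ballKernel ℓ x xᵢ` of a configuration `w = (xᵢ, vᵢ)ᵢ` of `n`
particles, the ball-averaged empirical fields are the weighted averages
`ρ̃ = n⁻¹ ∑ kᵢ`, `m̃ = n⁻¹ ∑ kᵢ vᵢ`, `ẽ = n⁻¹ ∑ kᵢ ‖vᵢ‖² / 2`, `c̃ = n⁻¹ ∑ kᵢ ‖vᵢ‖³`, and: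

* `integral_ballAverage_eq`: `∫ n⁻¹ ∑ kᵢ(x) G(vᵢ) dx = n⁻¹ ∑ G(vᵢ)` (unit mass of the kernel);
* `norm_ballMomentum_sq_le`: `‖m̃‖² ≤ 2 ρ̃ ẽ` (Cauchy–Schwarz);
* `norm_ballMomentum_le`: `‖m̃‖ ≤ ρ̃ / 2 + ẽ`;
* `ballEnergy_mul_norm_ballMomentum_le`: `ẽ ‖m̃‖ ≤ ρ̃ c̃ / 2` (Young `a² b ≤ (2a³ + b³)/3` on the
  symmetric double sum);
* `ballEnergy_le_trunc`, `ballCubic_le_trunc`: truncation of `ẽ` and `c̃` at a velocity level `L`.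

No definitions, no named facts.
-/

noncomputable section

namespace Summit.AtomisticToContinuum.HydrodynamicLimit.Theorems.NearConstantShortTimeHL

open scoped BigOperators ENNReal
open MeasureTheory Set Filter
open Literature.MathematicalPhysics.KineticTheory Literature.Analysis.FluidPDE Literature.Analysis.FunctionSpaces

/-! ### Elementary weighted-sum inequalities -/

/-- Monotonicity of nonnegatively weighted averages: `F ≤ G` pointwise gives
`n⁻¹ ∑ kᵢ Fᵢ ≤ n⁻¹ ∑ kᵢ Gᵢ` for `kᵢ ≥ 0`. [folklore] -/
theorem invMul_sum_mul_le_of_le {n : ℕ} {k F G : Fin n → ℝ} (hk : ∀ i, 0 ≤ k i)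
    (h : ∀ i, F i ≤ G i) :
    (n : ℝ)⁻¹ * ∑ i, k i * F i ≤ (n : ℝ)⁻¹ * ∑ i, k i * G i :=
  mul_le_mul_of_nonneg_left (Finset.sum_le_sum fun i _ => mul_le_mul_of_nonneg_left (h i) (hk i))
    (inv_nonneg.2 (Nat.cast_nonneg n))

/-- **Weighted Chebyshev / Young inequality.** For nonnegative weights `kᵢ` and nonnegative reals
`aᵢ`: `(∑ kᵢ aᵢ²) (∑ kᵢ aᵢ) ≤ (∑ kᵢ) (∑ kᵢ aᵢ³)`; proof by the pointwise Young inequality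
`aᵢ² aⱼ ≤ (2 aᵢ³ + aⱼ³) / 3` (i.e. `(aᵢ - aⱼ)² (2aᵢ + aⱼ) ≥ 0`) on the double sum. [folklore] -/
theorem sum_mul_sq_mul_sum_mul_le {ι : Type*} (s : Finset ι) {k a : ι → ℝ}
    (hk : ∀ i ∈ s, 0 ≤ k i) (ha : ∀ i ∈ s, 0 ≤ a i) :
    (∑ i ∈ s, k i * a i ^ 2) * (∑ i ∈ s, k i * a i) ≤ (∑ i ∈ s, k i) * ∑ i ∈ s, k i * a i ^ 3 := by
  have h1 : (∑ i ∈ s, k i * a i ^ 3) * (∑ j ∈ s, k j) = ∑ i ∈ s, ∑ j ∈ s, k i * a i ^ 3 * k j :=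
    Finset.sum_mul_sum _ _ _ _
  have h2 : (∑ i ∈ s, k i) * (∑ j ∈ s, k j * a j ^ 3) = ∑ i ∈ s, ∑ j ∈ s, k i * (k j * a j ^ 3) :=
    Finset.sum_mul_sum _ _ _ _
  rw [Finset.sum_mul_sum]
  calc ∑ i ∈ s, ∑ j ∈ s, k i * a i ^ 2 * (k j * a j)
      ≤ ∑ i ∈ s, ∑ j ∈ s, (2 / 3 * (k i * a i ^ 3 * k j) + 1 / 3 * (k i * (k j * a j ^ 3))) := by
        refine Finset.sum_le_sum fun i hi => Finset.sum_le_sum fun j hj => ?_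
        have h0 : 0 ≤ k i * k j * ((a i - a j) ^ 2 * (2 * a i + a j)) :=
          mul_nonneg (mul_nonneg (hk i hi) (hk j hj))
            (mul_nonneg (sq_nonneg _) (by linarith [ha i hi, ha j hj]))
        nlinarith [h0]
    _ = 2 / 3 * ((∑ i ∈ s, k i * a i ^ 3) * ∑ j ∈ s, k j) +
          1 / 3 * ((∑ i ∈ s, k i) * ∑ j ∈ s, k j * a j ^ 3) := by
        rw [h1, h2, Finset.mul_sum, Finset.mul_sum, ← Finset.sum_add_distrib]
        refine Finset.sum_congr rfl fun i _ => ?_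
        rw [Finset.mul_sum, Finset.mul_sum, ← Finset.sum_add_distrib]
    _ = (∑ i ∈ s, k i) * ∑ i ∈ s, k i * a i ^ 3 := by ring

/-! ### The ball-averaged momentum is dominated by the weighted speed average -/

/-- `‖m̃‖ ≤ n⁻¹ ∑ kᵢ ‖vᵢ‖` for the ball-averaged empirical momentum (triangle inequality, the
weights `kᵢ = ballKernel ℓ x xᵢ` being nonnegative). [folklore] -/
theorem norm_ballMomentum_le_sum {n : ℕ} (ℓ : ℝ) (x : T3) (w : Config n (Fin 3) T3) :
    ‖empiricalMomentumField w (ballKernel ℓ x)‖ ≤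
      (n : ℝ)⁻¹ * ∑ i, ballKernel ℓ x (w i).1 * ‖(w i).2‖ := by
  rw [empiricalMomentumField_eq_sum, norm_smul, Real.norm_of_nonneg (inv_nonneg.2 (Nat.cast_nonneg n))]
  refine mul_le_mul_of_nonneg_left ?_ (inv_nonneg.2 (Nat.cast_nonneg n))
  refine (norm_sum_le _ _).trans (le_of_eq (Finset.sum_congr rfl fun i _ => ?_))
  rw [norm_smul, Real.norm_of_nonneg (ballKernel_nonneg ℓ x _)]

/-! ### The registered stubs -/

/-- **Unit mass of the ball average.** For `0 < ℓ < 1/2` and any velocity observable `G`,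
`∫ n⁻¹ ∑ᵢ ballKernel ℓ x xᵢ · G(vᵢ) dx = n⁻¹ ∑ᵢ G(vᵢ)` (each kernel has unit space integral,
`integral_ballKernel_eq_one`). [folklore] -/
theorem integral_ballAverage_eq : ∀ {n : ℕ} {ℓ : ℝ}, 0 < ℓ → ℓ < 1 / 2 → ∀ (G : V3 → ℝ) (w : Config n (Fin 3) T3), ∫ x, (n : ℝ)⁻¹ * ∑ i, ballKernel ℓ x (w i).1 * G (w i).2 = (n : ℝ)⁻¹ * ∑ i, G (w i).2 := by
  intro n ℓ hℓ0 hℓ G w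
  have hint : ∀ i : Fin n, Integrable fun x : T3 => ballKernel ℓ x (w i).1 := fun i =>
    integrable_ballKernel ℓ _ (w i).1
  rw [integral_const_mul, integral_finsetSum _ fun i _ => (hint i).mul_const _]
  congr 1
  refine Finset.sum_congr rfl fun i _ => ?_
  have h1 : ∫ x : T3, ballKernel ℓ x (w i).1 = 1 := integral_ballKernel_eq_one hℓ0 hℓ (w i).1
  rw [integral_mul_const, h1, one_mul]

/-- **Cauchy–Schwarz for the ball averages:** `‖m̃‖² ≤ 2 ρ̃ ẽ`, i.e.
`‖∑ kᵢ vᵢ‖² ≤ (∑ kᵢ)(∑ kᵢ ‖vᵢ‖²)`. [folklore] -/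
theorem norm_ballMomentum_sq_le : ∀ {n : ℕ} (ℓ : ℝ) (x : T3) (w : Config n (Fin 3) T3), ‖empiricalMomentumField w (ballKernel ℓ x)‖ ^ 2 ≤ 2 * empiricalDensityField w (ballKernel ℓ x) * empiricalEnergyField w (ballKernel ℓ x) := by
  intro n ℓ x w
  have hle := norm_ballMomentum_le_sum ℓ x w
  rw [empiricalDensityField_eq_sum, empiricalEnergyField_eq_sum]
  have hCS : (∑ i, ballKernel ℓ x (w i).1 * ‖(w i).2‖) ^ 2 ≤
      (∑ i, ballKernel ℓ x (w i).1) * ∑ i, ballKernel ℓ x (w i).1 * ‖(w i).2‖ ^ 2 :=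
    Finset.sum_sq_le_sum_mul_sum_of_sq_le_mul _ (fun i _ => ballKernel_nonneg ℓ x _)
      (fun i _ => mul_nonneg (ballKernel_nonneg ℓ x _) (sq_nonneg _)) (fun i _ => le_of_eq (by ring))
  have h2 : ∑ i, ballKernel ℓ x (w i).1 * (‖(w i).2‖ ^ 2 / 2) =
      (∑ i, ballKernel ℓ x (w i).1 * ‖(w i).2‖ ^ 2) / 2 := by
    rw [Finset.sum_div]
    exact Finset.sum_congr rfl fun i _ => by ring
  calc ‖empiricalMomentumField w (ballKernel ℓ x)‖ ^ 2
      ≤ ((n : ℝ)⁻¹ * ∑ i, ballKernel ℓ x (w i).1 * ‖(w i).2‖) ^ 2 :=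
        pow_le_pow_left₀ (norm_nonneg _) hle 2
    _ = (n : ℝ)⁻¹ ^ 2 * (∑ i, ballKernel ℓ x (w i).1 * ‖(w i).2‖) ^ 2 := mul_pow _ _ _
    _ ≤ (n : ℝ)⁻¹ ^ 2 * ((∑ i, ballKernel ℓ x (w i).1) * ∑ i, ballKernel ℓ x (w i).1 * ‖(w i).2‖ ^ 2) :=
        mul_le_mul_of_nonneg_left hCS (sq_nonneg _)
    _ = 2 * ((n : ℝ)⁻¹ * ∑ i, ballKernel ℓ x (w i).1) *
          ((n : ℝ)⁻¹ * ∑ i, ballKernel ℓ x (w i).1 * (‖(w i).2‖ ^ 2 / 2)) := by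
        rw [h2]; ring

/-- **Linear domination of the momentum by mass and energy:** `‖m̃‖ ≤ ρ̃ / 2 + ẽ`
(from `‖v‖ ≤ 1/2 + ‖v‖²/2`, equivalently from `‖m̃‖² ≤ 2ρ̃ẽ ≤ (ρ̃/2 + ẽ)²`). [folklore] -/
theorem norm_ballMomentum_le : ∀ {n : ℕ} (ℓ : ℝ) (x : T3) (w : Config n (Fin 3) T3), ‖empiricalMomentumField w (ballKernel ℓ x)‖ ≤ empiricalDensityField w (ballKernel ℓ x) / 2 + empiricalEnergyField w (ballKernel ℓ x) := by
  intro n ℓ x w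
  refine (norm_ballMomentum_le_sum ℓ x w).trans ?_
  rw [empiricalDensityField_eq_sum, empiricalEnergyField_eq_sum]
  have hsum : ∑ i, ballKernel ℓ x (w i).1 * (1 / 2 + ‖(w i).2‖ ^ 2 / 2) =
      (∑ i, ballKernel ℓ x (w i).1) / 2 + ∑ i, ballKernel ℓ x (w i).1 * (‖(w i).2‖ ^ 2 / 2) := by
    rw [Finset.sum_div, ← Finset.sum_add_distrib]
    exact Finset.sum_congr rfl fun i _ => by ring
  calc (n : ℝ)⁻¹ * ∑ i, ballKernel ℓ x (w i).1 * ‖(w i).2‖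
      ≤ (n : ℝ)⁻¹ * ∑ i, ballKernel ℓ x (w i).1 * (1 / 2 + ‖(w i).2‖ ^ 2 / 2) :=
        invMul_sum_mul_le_of_le (fun i => ballKernel_nonneg ℓ x _) fun i => by
          nlinarith [sq_nonneg (‖(w i).2‖ - 1)]
    _ = (n : ℝ)⁻¹ * (∑ i, ballKernel ℓ x (w i).1) / 2 +
          (n : ℝ)⁻¹ * ∑ i, ballKernel ℓ x (w i).1 * (‖(w i).2‖ ^ 2 / 2) := by
        rw [hsum]; ring

/-- **Truncation of the ball-averaged energy at level `L`:**
`ẽ ≤ (L²/2) ρ̃ + n⁻¹ ∑ kᵢ 𝟙{L < ‖vᵢ‖} ‖vᵢ‖²/2` (pointwise `‖v‖²/2 ≤ L²/2 + 𝟙{L<‖v‖} ‖v‖²/2`).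
[folklore] -/
theorem ballEnergy_le_trunc : ∀ {n : ℕ} (ℓ : ℝ) (x : T3) (w : Config n (Fin 3) T3) {L : ℝ}, 0 ≤ L → empiricalEnergyField w (ballKernel ℓ x) ≤ L ^ 2 / 2 * empiricalDensityField w (ballKernel ℓ x) + (n : ℝ)⁻¹ * ∑ i, ballKernel ℓ x (w i).1 * Set.indicator {v : V3 | L < ‖v‖} (fun v => ‖v‖ ^ 2 / 2) (w i).2 := by
  intro n ℓ x w L hL
  rw [empiricalDensityField_eq_sum, empiricalEnergyField_eq_sum]
  have hsum : ∑ i, ballKernel ℓ x (w i).1 *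
        (L ^ 2 / 2 + Set.indicator {v : V3 | L < ‖v‖} (fun v => ‖v‖ ^ 2 / 2) (w i).2) =
      L ^ 2 / 2 * ∑ i, ballKernel ℓ x (w i).1 +
        ∑ i, ballKernel ℓ x (w i).1 * Set.indicator {v : V3 | L < ‖v‖} (fun v => ‖v‖ ^ 2 / 2) (w i).2 := by
    rw [Finset.mul_sum, ← Finset.sum_add_distrib]
    exact Finset.sum_congr rfl fun i _ => by ring
  calc (n : ℝ)⁻¹ * ∑ i, ballKernel ℓ x (w i).1 * (‖(w i).2‖ ^ 2 / 2)
      ≤ (n : ℝ)⁻¹ * ∑ i, ballKernel ℓ x (w i).1 *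
          (L ^ 2 / 2 + Set.indicator {v : V3 | L < ‖v‖} (fun v => ‖v‖ ^ 2 / 2) (w i).2) := by
        refine invMul_sum_mul_le_of_le (fun i => ballKernel_nonneg ℓ x _) fun i => ?_
        by_cases h : L < ‖(w i).2‖
        · rw [Set.indicator_of_mem (show (w i).2 ∈ {v : V3 | L < ‖v‖} from h)]
          nlinarith [sq_nonneg L]
        · rw [Set.indicator_of_notMem (show (w i).2 ∉ {v : V3 | L < ‖v‖} from h), add_zero]
          have h' : ‖(w i).2‖ ≤ L := le_of_not_gt h
          nlinarith [norm_nonneg (w i).2]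
    _ = L ^ 2 / 2 * ((n : ℝ)⁻¹ * ∑ i, ballKernel ℓ x (w i).1) + (n : ℝ)⁻¹ *
          ∑ i, ballKernel ℓ x (w i).1 * Set.indicator {v : V3 | L < ‖v‖} (fun v => ‖v‖ ^ 2 / 2) (w i).2 := by
        rw [hsum]; ring

/-- **Size of the energy flux on a ball:** `ẽ ‖m̃‖ ≤ ρ̃ c̃ / 2` with `c̃ = n⁻¹ ∑ kᵢ ‖vᵢ‖³`
(`‖m̃‖ ≤ n⁻¹∑ kᵢ‖vᵢ‖` and the weighted Chebyshev inequality `(∑ k a²)(∑ k a) ≤ (∑ k)(∑ k a³)`).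
[folklore] -/
theorem ballEnergy_mul_norm_ballMomentum_le : ∀ {n : ℕ} (ℓ : ℝ) (x : T3) (w : Config n (Fin 3) T3), empiricalEnergyField w (ballKernel ℓ x) * ‖empiricalMomentumField w (ballKernel ℓ x)‖ ≤ empiricalDensityField w (ballKernel ℓ x) / 2 * ((n : ℝ)⁻¹ * ∑ i, ballKernel ℓ x (w i).1 * ‖(w i).2‖ ^ 3) := by
  intro n ℓ x w
  have hle := norm_ballMomentum_le_sum ℓ x w
  have hE : 0 ≤ empiricalEnergyField w (ballKernel ℓ x) := by
    rw [empiricalEnergyField_eq_sum]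
    exact mul_nonneg (inv_nonneg.2 (Nat.cast_nonneg n))
      (Finset.sum_nonneg fun i _ => mul_nonneg (ballKernel_nonneg ℓ x _) (by positivity))
  refine (mul_le_mul_of_nonneg_left hle hE).trans ?_
  rw [empiricalEnergyField_eq_sum, empiricalDensityField_eq_sum]
  have hC := sum_mul_sq_mul_sum_mul_le (Finset.univ : Finset (Fin n))
    (k := fun i => ballKernel ℓ x (w i).1) (a := fun i => ‖(w i).2‖)
    (fun i _ => ballKernel_nonneg ℓ x _) (fun i _ => norm_nonneg _)
  have h2 : ∑ i, ballKernel ℓ x (w i).1 * (‖(w i).2‖ ^ 2 / 2) =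
      (∑ i, ballKernel ℓ x (w i).1 * ‖(w i).2‖ ^ 2) / 2 := by
    rw [Finset.sum_div]
    exact Finset.sum_congr rfl fun i _ => by ring
  rw [h2]
  have hn : 0 ≤ (n : ℝ)⁻¹ ^ 2 := sq_nonneg _
  calc (n : ℝ)⁻¹ * ((∑ i, ballKernel ℓ x (w i).1 * ‖(w i).2‖ ^ 2) / 2) *
        ((n : ℝ)⁻¹ * ∑ i, ballKernel ℓ x (w i).1 * ‖(w i).2‖)
      = (n : ℝ)⁻¹ ^ 2 / 2 * ((∑ i, ballKernel ℓ x (w i).1 * ‖(w i).2‖ ^ 2) *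
          ∑ i, ballKernel ℓ x (w i).1 * ‖(w i).2‖) := by ring
    _ ≤ (n : ℝ)⁻¹ ^ 2 / 2 * ((∑ i, ballKernel ℓ x (w i).1) *
          ∑ i, ballKernel ℓ x (w i).1 * ‖(w i).2‖ ^ 3) :=
        mul_le_mul_of_nonneg_left hC (by positivity)
    _ = (n : ℝ)⁻¹ * (∑ i, ballKernel ℓ x (w i).1) / 2 *
          ((n : ℝ)⁻¹ * ∑ i, ballKernel ℓ x (w i).1 * ‖(w i).2‖ ^ 3) := by ring

/-- **Truncation of the ball-averaged cubic moment at level `L`:**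
`c̃ ≤ 2L ẽ + n⁻¹ ∑ kᵢ 𝟙{L < ‖vᵢ‖} ‖vᵢ‖³` (pointwise `‖v‖³ ≤ 2L · ‖v‖²/2 + 𝟙{L<‖v‖} ‖v‖³`).
[folklore] -/
theorem ballCubic_le_trunc : ∀ {n : ℕ} (ℓ : ℝ) (x : T3) (w : Config n (Fin 3) T3) {L : ℝ}, 0 ≤ L → (n : ℝ)⁻¹ * ∑ i, ballKernel ℓ x (w i).1 * ‖(w i).2‖ ^ 3 ≤ 2 * L * empiricalEnergyField w (ballKernel ℓ x) + (n : ℝ)⁻¹ * ∑ i, ballKernel ℓ x (w i).1 * Set.indicator {v : V3 | L < ‖v‖} (fun v => ‖v‖ ^ 3) (w i).2 := by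
  intro n ℓ x w L hL
  rw [empiricalEnergyField_eq_sum]
  have hsum : ∑ i, ballKernel ℓ x (w i).1 *
        (2 * L * (‖(w i).2‖ ^ 2 / 2) + Set.indicator {v : V3 | L < ‖v‖} (fun v => ‖v‖ ^ 3) (w i).2) =
      2 * L * ∑ i, ballKernel ℓ x (w i).1 * (‖(w i).2‖ ^ 2 / 2) +
        ∑ i, ballKernel ℓ x (w i).1 * Set.indicator {v : V3 | L < ‖v‖} (fun v => ‖v‖ ^ 3) (w i).2 := by
    rw [Finset.mul_sum, ← Finset.sum_add_distrib]
    exact Finset.sum_congr rfl fun i _ => by ring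
  calc (n : ℝ)⁻¹ * ∑ i, ballKernel ℓ x (w i).1 * ‖(w i).2‖ ^ 3
      ≤ (n : ℝ)⁻¹ * ∑ i, ballKernel ℓ x (w i).1 *
          (2 * L * (‖(w i).2‖ ^ 2 / 2) + Set.indicator {v : V3 | L < ‖v‖} (fun v => ‖v‖ ^ 3) (w i).2) := by
        refine invMul_sum_mul_le_of_le (fun i => ballKernel_nonneg ℓ x _) fun i => ?_
        have hv : 0 ≤ ‖(w i).2‖ := norm_nonneg _
        by_cases h : L < ‖(w i).2‖
        · rw [Set.indicator_of_mem (show (w i).2 ∈ {v : V3 | L < ‖v‖} from h)]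
          nlinarith [mul_nonneg hL (sq_nonneg ‖(w i).2‖)]
        · rw [Set.indicator_of_notMem (show (w i).2 ∉ {v : V3 | L < ‖v‖} from h), add_zero]
          have h' : ‖(w i).2‖ ≤ L := le_of_not_gt h
          nlinarith [mul_le_mul_of_nonneg_right h' (sq_nonneg ‖(w i).2‖)]
    _ = 2 * L * ((n : ℝ)⁻¹ * ∑ i, ballKernel ℓ x (w i).1 * (‖(w i).2‖ ^ 2 / 2)) + (n : ℝ)⁻¹ *
          ∑ i, ballKernel ℓ x (w i).1 * Set.indicator {v : V3 | L < ‖v‖} (fun v => ‖v‖ ^ 3) (w i).2 := by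
        rw [hsum]; ring

end Summit.AtomisticToContinuum.HydrodynamicLimit.Theorems.NearConstantShortTimeHL

end
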